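import Summits.BirchSwinnertonDyer.Rank1Residual.X11b.KummerStructureDuality
import HarnessLib

/-!
# Class X11b, routes p2/R1: RELAXING THE SELMER CONDITION AT ONE FINITE PLACE — THE EXACT INDEX
# `[H¹_{𝓛, ⊤ at v₀}(K, E[n]) : Sel⁽ⁿ⁾(E/K)] = [𝓛_{v₀} : loc_{v₀} Sel⁽ⁿ⁾(E/K)]` by Poitou–Tate (both halves)
# (cell `b2b-bsdres`, sub-cell `multr1-p2`, gen 19)

HONEST FRAMING (verbatim, cell `b2b-bsdres`): the goal of the cell is to DELETE the
COMBINATION-SHAPED residual classes for ALL analytic-rank `≤ 1` curves over `ℚ` — "full BSD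
formula for every rank `≤ 1` curve in class `C`" assembled STRICTLY from published theorems — so
that the rank-`≤ 1` remainder becomes exactly the CONSTRUCTION-SHAPED classes, which are TYPED
(missing-input Props), NOT attempted; this is not "finishing BSD". Research route `p2` for class
X11b; no claim beyond the stated class; nothing booked; X11b stays CONSTRUCTION-SHAPED. Theorems only;
no `sorry`; no new named fact (the tree's Poitou–Tate fact for Selmer structures
`poitouTate_selmerStructure_duality` — Howard Thm. 2.1.11 / Milne I 4.10(b) — and Tate's local Euler
characteristic `localEulerPoincareCharacteristic` — Milne I 2.8 — enter as hypotheses).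

## What this file proves — JSW17 Prop. 3.2.1 "`#im α = #coker β`" EXACTLY, at finite level (step 4)

Gen 15 (`BDPRouteRelaxation`) proved `[H¹_{𝓛,⊤ at v₀} : Sel⁽ⁿ⁾] ≤ [E(K_{v₀}) : nE(K_{v₀}) + im E(K)]`
from the reciprocity half of Poitou–Tate.  Here, for `K` with all infinite places complex, `n = p^k`,
the Poitou–Tate family with `SelmerComplement` (tree fact p229282), Tate's local Euler characteristic:
* `invWeilPairing_localization_eq_zero_of_mem_selmerGroup` — reciprocity against a SELMER class;
* **`sup_map_kummerOutside_eq_annLeft`** — `𝓛_{v₀} + loc_{v₀}(H¹_{𝓛,⊤ at v₀}) = {}^⊥(loc_{v₀} Sel⁽ⁿ⁾)`: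
  `⊆` reciprocity, `⊇` SURJECTIVITY (Howard Thm. 2.1.11 (i) for the Kummer structure `𝓚 ≤ 𝓚[⊤ at v₀]`,
  the obstruction killed by the self-duality of `𝓚`, gen 19 `KummerStructureDuality`);
* **`relIndex_selmerGroup_kummerOutside_eq`** — `[H¹_{𝓛,⊤ at v₀} : Sel⁽ⁿ⁾] = [𝓛_{v₀} : loc_{v₀} Sel⁽ⁿ⁾]`;
* `nsmul_mem_selmerGroup_of_mem_kummerOutside` — `c • H¹_{𝓛,⊤ at v₀} ⊆ Sel⁽ⁿ⁾` if `c` kills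
  `𝓛_{v₀}/loc Sel⁽ⁿ⁾`.
At `v₀ = 𝔭̄` this is the exact Part B of the base Selmer count (Cas18 (3.2.1); R1's atom (P6)
`BaseSelmerCountAt`). Nothing booked; labels unchanged.

References: [JetchevSkinnerWan2017] Prop. 3.2.1 (arXiv:1512.06894 pp. 10–11); [MilneADT2006] I
Cor. 2.3, Thm. 2.8, Cor. 3.4, Thm. 4.10, Lemma 6.15; [Howard2004HeegnerKolyvagin] Thm. 2.1.11;
[Castella2018] (3.2.1).
-/

noncomputable section

open scoped Classical

namespace Summit.BirchSwinnertonDyer.Rank1Residual.X11b.Relaxation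

open WeierstrassCurve Literature.NumberTheory.EllipticCurves Literature.NumberTheory.GaloisRepresentations
  Literature.NumberTheory.GaloisCohomology Field Function NumberField IsDedekindDomain
open Literature.NumberTheory.GaloisRepresentations.DiscreteGaloisModule (mu MuCarrier SelmerStructure
  localTatePairingZMod tateDual)
open Summit.BirchSwinnertonDyer.Rank1Residual.X11b.FiniteDuality
open Summit.BirchSwinnertonDyer.Rank1Residual.X11b.KummerDuality
open Summit.BirchSwinnertonDyer.Rank1Residual.X11b.LocBridge
open Summit.BirchSwinnertonDyer.Rank1Residual.X11b.Levels
open scoped ContRepresentation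

-- Cup products need `LocallyCompactSpace Γ`; as in the tree's cup-product files, the compactness of
-- absolute Galois groups is a local instance only.
attribute [local instance] absoluteGaloisGroup_compactSpace

attribute [local instance] finite_geomTorsion_of_neZero Literature.NumberTheory.EllipticCurves.finite_muCarrier

variable {K : Type} [Field K] [NumberField K] (W : WeierstrassCurve K) [W.IsElliptic]
variable (n : ℕ) [NeZero n]

section WithPairing

variable (e : geomTorsion W n → geomTorsion W n → AlgebraicClosure K)
  (hμ : ∀ S T, e S T ^ n = 1)
  (hadd₁ : ∀ S₁ S₂ T, e (S₁ + S₂) T = e S₁ T * e S₂ T)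
  (hadd₂ : ∀ S T₁ T₂, e S (T₁ + T₂) = e S T₁ * e S T₂)
  (hgal : ∀ (σ : absoluteGaloisGroup K) (S T : geomTorsion W n), σ • e S T = e (σ • S) (σ • T))
  (halt : ∀ T, e T T = 1) (hnondeg : ∀ T, (∀ S, e S T = 1) → T = 0)
  (inv : LocalInvariants K n)

include halt in
/-- **Reciprocity against a Selmer class**: for `x ∈ H¹_{𝓛, ⊤ at v₀}(K, E[n])` (Kummer condition at
every place `≠ v₀`) and `s ∈ Sel⁽ⁿ⁾(E/K)`, `inv_{v₀}(loc_{v₀} x ∪ₑ loc_{v₀} s) = 0` — all other local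
terms of the Poitou–Tate sum vanish by isotropy. [cite: MilneADT2006, Ch. I, Thm. 4.10(b)]
[cite: JetchevSkinnerWan2017, Prop. 3.2.1 (proof)] -/
theorem invWeilPairing_localization_eq_zero_of_mem_selmerGroup (hPT : inv.SumLocalTermEqZero)
    (v₀ : Place K) {x : galoisCohomology (W.torsionGaloisModule n) 1} (hx : x ∈ kummerOutside W n {v₀})
    {s : galoisCohomology (W.torsionGaloisModule n) 1} (hs : s ∈ selmerGroup W (n : ℤ)) :
    invWeilPairing W n e hμ hadd₁ hadd₂ hgal inv v₀
      (galoisCohomology.localization (W.torsionGaloisModule n) v₀ 1 x)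
      (galoisCohomology.localization (W.torsionGaloisModule n) v₀ 1 s) = 0 := by
  have hS : ∀ v ∉ ({v₀} : Finset (Place K)), inv v ((weilContPairingLocal W n e hμ hadd₁ hadd₂ hgal v).cupProduct
      (galoisCohomology.localization (W.torsionGaloisModule n) v 1 x)
      (galoisCohomology.localization (W.torsionGaloisModule n) v 1 s)) = 0 := by
    intro v hv
    have hxv : galoisCohomology.localization (W.torsionGaloisModule n) v 1 x ∈ W.kummerSelmerStructure n v :=
      (mem_kummerOutside_iff W n {v₀} x).mp hx v hv
    have hsv : galoisCohomology.localization (W.torsionGaloisModule n) v 1 s ∈ W.kummerSelmerStructure n v :=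
      (W.mem_selmerGroup_iff_forall_localization_mem n s).mp hs v
    exact invWeilPairing_eq_zero_of_mem W n e hμ hadd₁ hadd₂ hgal halt inv v hxv hsv
  have h := sum_inv_weilCupProduct_localization_eq_zero W n e hμ hadd₁ hadd₂ hgal inv hPT x s {v₀} hS
  rwa [Finset.sum_singleton] at h

end WithPairing

section Main

variable (p k : ℕ) [Fact p.Prime] (v₀ : HeightOneSpectrum (𝓞 K))

attribute [local instance] Levels.neZero_pow

/-- **`𝓛_{v₀} + loc_{v₀}(H¹_{𝓛, ⊤ at v₀}) = {}^⊥(loc_{v₀} Sel⁽ⁿ⁾)` — BOTH HALVES OF POITOU–TATE at one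
finite place.** For `K` with all infinite places complex, `n = p^k`, a Weil pairing `e`, a
Poitou–Tate family `inv` with `SelmerComplement` (Howard Thm. 2.1.11 (i)) and `IsPerfect`, Tate's local
Euler characteristic at every finite place, and a finite `T ∋ v₀` containing `∞ ∪ {v ∣ p} ∪ {bad}`:
the classes of `H¹(K_{v₀}, E[n])` annihilating (on the left, under `inv_{v₀}(· ∪ₑ ·)`) the local image of
the Selmer group are EXACTLY `𝓛_{v₀} + loc_{v₀}(kummerOutside W n {v₀})`.  `⊆`: isotropy + reciprocity;
`⊇`: SURJECTIVITY — `SelmerComplement` for the Kummer structure `𝓚 ≤ 𝓚[⊤ at v₀]` with test family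
`(τ at v₀, 0 elsewhere)`; its obstruction `⟨τ, loc_{v₀} y⟩ = 0` for `y ∈ H¹_{𝓚^*}(K, E[n]^D)` holds
because `y = H¹(w) s` with `s ∈ Sel⁽ⁿ⁾` (self-duality of `𝓚`, gen 19) and
`⟨τ, H¹(w_{v₀}) loc s⟩ = inv_{v₀}(τ ∪ₑ loc s)`.
[cite: Howard2004HeegnerKolyvagin, Thm. 2.1.11 (arXiv:1202.6340 p. 6)]
[cite: JetchevSkinnerWan2017, Prop. 3.2.1 (proof, arXiv:1512.06894 pp. 10–11)]
[cite: MilneADT2006, Ch. I, Thm. 4.10(b) and Lemma 6.15] -/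
theorem sup_map_kummerOutside_eq_annLeft (hK : ∀ w : InfinitePlace K, w.IsComplex)
    (e : geomTorsion W (p ^ k) → geomTorsion W (p ^ k) → AlgebraicClosure K)
    (hμ : ∀ S T, e S T ^ (p ^ k) = 1)
    (hadd₁ : ∀ S₁ S₂ T, e (S₁ + S₂) T = e S₁ T * e S₂ T)
    (hadd₂ : ∀ S T₁ T₂, e S (T₁ + T₂) = e S T₁ * e S T₂)
    (hgal : ∀ (σ : absoluteGaloisGroup K) (S T : geomTorsion W (p ^ k)), σ • e S T = e (σ • S) (σ • T))
    (halt : ∀ T, e T T = 1) (hnondeg : ∀ T, (∀ S, e S T = 1) → T = 0)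
    (inv : LocalInvariants K (p ^ k)) (hperf : inv.IsPerfect) (hsum : inv.SumLocalTermEqZero)
    (hcompl : inv.SelmerComplement)
    (hEP : ∀ v : HeightOneSpectrum (𝓞 K), localEulerPoincareCharacteristic (v.adicCompletion K))
    (hk : k ≠ 0)
    (T : Finset (Place K)) (hinf : ∀ w : InfinitePlace K, (Sum.inl w : Place K) ∈ T)
    (hp : ∀ v : HeightOneSpectrum (𝓞 K), ((p : ℕ) : 𝓞 K) ∈ v.asIdeal → (Sum.inr v : Place K) ∈ T)
    (hbad : ∀ v : HeightOneSpectrum (𝓞 K), ¬ W.HasGoodReductionAt v → (Sum.inr v : Place K) ∈ T)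
    (hv₀ : (Sum.inr v₀ : Place K) ∈ T) :
    W.kummerSelmerStructure ((p ^ k : ℕ) : ℤ) (Sum.inr v₀) ⊔
        (kummerOutside W (p ^ k) {Sum.inr v₀}).map
          (galoisCohomology.localization (W.torsionGaloisModule ((p ^ k : ℕ) : ℤ)) (Sum.inr v₀) 1) =
      annLeft (invWeilPairing W (p ^ k) e hμ hadd₁ hadd₂ hgal inv (Sum.inr v₀))
        ((selmerGroup W ((p ^ k : ℕ) : ℤ)).map
          (galoisCohomology.localization (W.torsionGaloisModule ((p ^ k : ℕ) : ℤ)) (Sum.inr v₀) 1)) := by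
  classical
  have hprime : p.Prime := Fact.out
  have hpp : IsPrimePow (p ^ k) := hprime.isPrimePow.pow hk
  -- notation
  set M := W.torsionGaloisModule ((p ^ k : ℕ) : ℤ) with hM
  set loc := galoisCohomology.localization M (Sum.inr v₀) 1 with hloc
  set b := invWeilPairing W (p ^ k) e hμ hadd₁ hadd₂ hgal inv (Sum.inr v₀) with hb
  set L := W.kummerSelmerStructure ((p ^ k : ℕ) : ℤ) (Sum.inr v₀) with hL
  set KO := kummerOutside W (p ^ k) {Sum.inr v₀} with hKO
  set HS := (selmerGroup W ((p ^ k : ℕ) : ℤ)).map loc with hHS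
  -- self-duality of the Kummer structure at every place
  have hmax := annRight_invWeilPairing_kummerSelmerStructure_eq W (p ^ k) e hμ hadd₁ hadd₂ hgal halt
    hnondeg inv hK hpp hperf hEP
  apply le_antisymm
  · -- `⊆`: isotropy and reciprocity
    refine sup_le ?_ ?_
    · intro x hx
      rw [mem_annLeft_iff]
      rintro _ ⟨s, hs, rfl⟩
      exact invWeilPairing_eq_zero_of_mem W (p ^ k) e hμ hadd₁ hadd₂ hgal halt inv (Sum.inr v₀) hx
        ((W.mem_selmerGroup_iff_forall_localization_mem ((p ^ k : ℕ) : ℤ) s).mp hs (Sum.inr v₀))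
    · rintro _ ⟨x, hx, rfl⟩
      rw [mem_annLeft_iff]
      rintro _ ⟨s, hs, rfl⟩
      exact invWeilPairing_localization_eq_zero_of_mem_selmerGroup W (p ^ k) e hμ hadd₁ hadd₂ hgal halt
        inv hsum (Sum.inr v₀) hx hs
  · -- `⊇`: surjectivity (Howard Thm. 2.1.11 (i))
    intro τ hτ
    rw [mem_annLeft_iff] at hτ
    -- the two structures
    set 𝓕 : SelmerStructure M := W.kummerSelmerStructure ((p ^ k : ℕ) : ℤ) with h𝓕
    set 𝓖 : SelmerStructure M :=
      Function.update (W.kummerSelmerStructure ((p ^ k : ℕ) : ℤ)) (Sum.inr v₀) ⊤ with h𝓖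
    have hMn : ∀ m : W.geomTorsion ((p ^ k : ℕ) : ℤ), (p ^ k) • m = 0 := fun m ↦
      AddSubgroup.torsionBy.nsmul m
    have hTout : ∀ v : HeightOneSpectrum (𝓞 K), (Sum.inr v : Place K) ∉ T →
        ((p ^ k : ℕ) : 𝓞 K) ∉ v.asIdeal ∧ GaloisRep.IsUnramifiedAt v M := by
      intro v hv
      have hpv : ((p : ℕ) : 𝓞 K) ∉ v.asIdeal := fun h ↦ hv (hp v h)
      have hgood : W.HasGoodReductionAt v := by
        by_contra hbad'
        exact hv (hbad v hbad')
      exact ⟨AcSelmer.natCast_pow_not_mem p hpv _,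
        AcSelmer.isUnramifiedAt_torsionGaloisModule W hgood (AcSelmer.intCast_pow_not_mem p hpv _)⟩
    have h𝓕ur : 𝓕.IsUnramifiedOutside T :=
      kummerSelmerStructure_isUnramifiedOutside W p k T hinf hp hbad
    have h𝓖ur : 𝓖.IsUnramifiedOutside T :=
      update_top_isUnramifiedOutside W (p ^ k) (Sum.inr v₀) hv₀ h𝓕ur
    -- the test family: `τ` at `v₀`, `0` elsewhere
    set t : Π v : Place K, galoisCohomology (M.toLocal v) 1 := Pi.single (Sum.inr v₀) τ with ht
    have htv₀ : t (Sum.inr v₀) = τ := by rw [ht, Pi.single_eq_same]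
    have ht_ne : ∀ v, v ≠ Sum.inr v₀ → t v = 0 := fun v hv ↦ by rw [ht, Pi.single_eq_of_ne hv]
    have htG : ∀ v ∈ T, t v ∈ 𝓖 v := by
      intro v _
      by_cases hv : v = Sum.inr v₀
      · subst hv
        rw [h𝓖, Function.update_self]
        exact AddSubgroup.mem_top _
      · rw [ht_ne v hv]
        exact zero_mem _
    -- the obstruction vanishes
    have hobs : ∀ y ∈ (inv.dualSelmerStructure M 𝓕).selmerGroup,
        ∑ v ∈ T, localTatePairingZMod M (p ^ k) v (inv v) (t v)
          (galoisCohomology.localization (M.tateDual (p ^ k)) v 1 y) = 0 := by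
      intro y hy
      rw [Finset.sum_eq_single (Sum.inr v₀) (fun v _ hv ↦ by
        rw [ht_ne v hv, map_zero, AddMonoidHom.zero_apply]) (fun h ↦ absurd hv₀ h), htv₀]
      -- `y = H¹(w) s` with `s ∈ Sel⁽ⁿ⁾`
      set s := galoisCohomology.map (weilDualInv W (p ^ k) e hμ hadd₁ hadd₂ hgal hnondeg) 1 y with hs
      have hsSel : s ∈ selmerGroup W ((p ^ k : ℕ) : ℤ) :=
        map_weilDualInv_mem_selmerGroup_of_mem_dualSelmerGroup W (p ^ k) e hμ hadd₁ hadd₂ hgal hnondeg inv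
          hmax hy
      have hys : galoisCohomology.map (weilDualIntertwining W (p ^ k) e hμ hadd₁ hadd₂ hgal) 1 s = y := by
        rw [hs, map_weilDual_map_weilDualInv]
      rw [← hys, localization_map_one, localTatePairingZMod_map_weilDual]
      exact hτ _ ⟨s, hsSel, rfl⟩
    -- Poitou–Tate: the lift exists
    obtain ⟨x, hx, hxt⟩ := (hcompl M hMn T hTout 𝓕 𝓖
      (kummerSelmerStructure_le_update_top W (p ^ k) (Sum.inr v₀)) h𝓕ur h𝓖ur).1 t htG hobs
    have hxKO : x ∈ KO := by
      rw [hKO, ← selmerGroup_update_top_eq_kummerOutside W (p ^ k) (Sum.inr v₀)]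
      exact hx
    have hv := hxt (Sum.inr v₀) hv₀
    rw [htv₀] at hv
    -- `τ = loc x - (loc x - τ)`
    have hτeq : τ = loc x + (-(loc x - τ)) := by abel
    rw [hτeq]
    exact AddSubgroup.add_mem _ (AddSubgroup.mem_sup_right ⟨x, hxKO, rfl⟩)
      (AddSubgroup.mem_sup_left (neg_mem hv))

/-- **THE EXACT RELAXATION INDEX (JSW17 Prop. 3.2.1 "`#im α = #coker β`", finite level, both halves of
Poitou–Tate).** Under the hypotheses of `sup_map_kummerOutside_eq_annLeft`:

  `[H¹_{𝓛, ⊤ at v₀}(K, E[p^k]) : Sel^{(p^k)}(E/K)] = [𝓛_{v₀} : loc_{v₀}(Sel^{(p^k)}(E/K))]`.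

Proof: `x ↦ loc_{v₀} x` embeds the left quotient onto `(𝓛_{v₀} + loc(H¹_{𝓛,⊤}))/𝓛_{v₀} = N'/𝓛_{v₀}`,
`N' = {}^⊥(loc Sel)` (`sup_map_kummerOutside_eq_annLeft`), and `#N' · #loc(Sel) = #H¹(K_{v₀},E[n]) = #𝓛²`
(perfectness + Euler characteristic), so `[N' : 𝓛] = [𝓛 : loc Sel]`.  Gen 15's
`relIndex_selmerGroup_kummerOutside_le` was the inequality `≤ [E(K_{v₀}) : nE(K_{v₀}) + im E(K)]`.
[cite: JetchevSkinnerWan2017, Prop. 3.2.1 (proof, arXiv:1512.06894 pp. 10–11)]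
[cite: Howard2004HeegnerKolyvagin, Thm. 2.1.11 (arXiv:1202.6340 p. 6)]
[cite: MilneADT2006, Ch. I, Thm. 4.10(b), Cor. 2.3, Thm. 2.8] -/
theorem relIndex_selmerGroup_kummerOutside_eq (hK : ∀ w : InfinitePlace K, w.IsComplex)
    (hPT : poitouTate_selmerStructure_duality K)
    (hEP : ∀ v : HeightOneSpectrum (𝓞 K), localEulerPoincareCharacteristic (v.adicCompletion K))
    (hk : k ≠ 0)
    (T : Finset (Place K)) (hinf : ∀ w : InfinitePlace K, (Sum.inl w : Place K) ∈ T)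
    (hp : ∀ v : HeightOneSpectrum (𝓞 K), ((p : ℕ) : 𝓞 K) ∈ v.asIdeal → (Sum.inr v : Place K) ∈ T)
    (hbad : ∀ v : HeightOneSpectrum (𝓞 K), ¬ W.HasGoodReductionAt v → (Sum.inr v : Place K) ∈ T)
    (hv₀ : (Sum.inr v₀ : Place K) ∈ T) :
    (selmerGroup W ((p ^ k : ℕ) : ℤ)).relIndex (kummerOutside W (p ^ k) {Sum.inr v₀}) =
      ((selmerGroup W ((p ^ k : ℕ) : ℤ)).map
          (galoisCohomology.localization (W.torsionGaloisModule ((p ^ k : ℕ) : ℤ)) (Sum.inr v₀) 1)).relIndex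
        (W.kummerSelmerStructure ((p ^ k : ℕ) : ℤ) (Sum.inr v₀)) := by
  classical
  haveI : PerfectField K := PerfectField.ofCharZero
  haveI : CharZero (v₀.adicCompletion K) := charZero_adicCompletion v₀
  have hprime : p.Prime := Fact.out
  have hpp : IsPrimePow (p ^ k) := hprime.isPrimePow.pow hk
  have hn2 : 2 ≤ p ^ k := le_trans hprime.two_le (Nat.le_self_pow hk p)
  obtain ⟨e, hμ, hadd₁, hadd₂, halt, hnondeg, hgal⟩ :=
    exists_weilPairing_holds W (p ^ k) hn2 (by exact_mod_cast NeZero.ne (p ^ k))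
  obtain ⟨inv, hperf, hsum, -, hcompl⟩ := hPT (p ^ k)
  -- the Euler-characteristic count (stated before the abbreviations, so that they rewrite it)
  have hEuler : Nat.card (galoisCohomology ((W.torsionGaloisModule ((p ^ k : ℕ) : ℤ)).toLocal (Sum.inr v₀)) 1) =
      (Nat.card (nsmulAddMonoidHom (p ^ k) : (W.baseChange (v₀.adicCompletion K)).toAffine.Point →+ _).ker *
        Nat.card (v₀.adicCompletionIntegers K ⧸
          Ideal.span {((p ^ k : ℕ) : v₀.adicCompletionIntegers K)})) ^ 2 :=
    natCard_galoisCohomology_one_torsion_adicCompletion_eq_sq W v₀ (p ^ k) hpp (hEP v₀)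
  have hLcard := W.natCard_kummerSelmerStructure_inr v₀ (NeZero.ne (p ^ k))
  have hbij := invWeilPairing_bijective W (p ^ k) e hμ hadd₁ hadd₂ hgal hnondeg inv v₀ (hperf v₀).1.1
  -- notation
  set M := W.torsionGaloisModule ((p ^ k : ℕ) : ℤ) with hM
  set loc := galoisCohomology.localization M (Sum.inr v₀) 1 with hloc
  set b := invWeilPairing W (p ^ k) e hμ hadd₁ hadd₂ hgal inv (Sum.inr v₀) with hb
  set L := W.kummerSelmerStructure ((p ^ k : ℕ) : ℤ) (Sum.inr v₀) with hL
  set KO := kummerOutside W (p ^ k) {Sum.inr v₀} with hKO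
  set HS := (selmerGroup W ((p ^ k : ℕ) : ℤ)).map loc with hHS
  set N' := annLeft b HS with hN'
  haveI hfinA : Finite (galoisCohomology (M.toLocal (Sum.inr v₀)) 1) := by
    change Finite (galoisCohomology (GaloisRep.restrictField (v₀.adicCompletion K)
      (W.torsionGaloisModule ((p ^ k : ℕ) : ℤ))) 1)
    exact finite_galoisCohomology_one_of_isNonarchimedeanLocalField _
  -- (1) `Sel = comap L ⊓ KO`
  have hSel : selmerGroup W ((p ^ k : ℕ) : ℤ) = L.comap loc ⊓ KO := by
    apply le_antisymm
    · intro c hc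
      exact ⟨(W.mem_selmerGroup_iff_forall_localization_mem ((p ^ k : ℕ) : ℤ) c).mp hc (Sum.inr v₀),
        selmerGroup_le_kummerOutside W (p ^ k) _ hc⟩
    · rintro c ⟨hc₀, hcKO⟩
      refine mem_selmerGroup_of_mem_kummerOutside W (p ^ k) hcKO fun v => ?_
      obtain ⟨v, hv⟩ := v
      rw [Finset.mem_singleton] at hv
      subst hv
      exact hc₀
  -- (2) the relative index through `loc`
  have h2' : (L.comap loc ⊓ KO).relIndex KO = L.relIndex (L ⊔ KO.map loc) := by
    rw [AddSubgroup.inf_relIndex_right, AddSubgroup.relIndex_comap, AddSubgroup.relIndex_sup_left]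
  have h2 : (selmerGroup W ((p ^ k : ℕ) : ℤ)).relIndex KO = L.relIndex (L ⊔ KO.map loc) := by
    rw [hSel]; exact h2'
  -- (3) `L ⊔ loc KO = N'`
  have h3 : L ⊔ KO.map loc = N' :=
    sup_map_kummerOutside_eq_annLeft W p k v₀ hK e hμ hadd₁ hadd₂ hgal halt hnondeg inv hperf hsum hcompl
      hEP hk T hinf hp hbad hv₀
  -- (4) `HS ≤ L`
  have hHSL : HS ≤ L := by
    rintro _ ⟨s, hs, rfl⟩
    exact (W.mem_selmerGroup_iff_forall_localization_mem ((p ^ k : ℕ) : ℤ) s).mp hs (Sum.inr v₀)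
  have hLN : L ≤ N' := h3 ▸ le_sup_left
  -- (5) `#N' · #HS = #A = #L²`, so `[N' : L] = [L : HS]`
  have hA : ∀ x : galoisCohomology (M.toLocal (Sum.inr v₀)) 1, (p ^ k) • x = 0 :=
    nsmul_continuousCohomology_one_eq_zero _ (p ^ k)
      (fun T : geomTorsion W (p ^ k) => AddSubgroup.torsionBy.nsmul T)
  have hNH : Nat.card N' * Nat.card HS = Nat.card (galoisCohomology (M.toLocal (Sum.inr v₀)) 1) :=
    natCard_annLeft_mul hA b hbij HS
  have hAL : Nat.card (galoisCohomology (M.toLocal (Sum.inr v₀)) 1) = Nat.card L * Nat.card L := by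
    rw [hEuler, hLcard, sq]
  have hNL : L.relIndex N' * Nat.card L = Nat.card N' := by
    rw [AddSubgroup.relIndex, mul_comm, ← Nat.card_congr (AddSubgroup.addSubgroupOfEquivOfLe hLN).toEquiv]
    exact AddSubgroup.card_mul_index _
  have hLH : HS.relIndex L * Nat.card HS = Nat.card L := by
    rw [AddSubgroup.relIndex, mul_comm, ← Nat.card_congr (AddSubgroup.addSubgroupOfEquivOfLe hHSL).toEquiv]
    exact AddSubgroup.card_mul_index _
  have hLpos : 0 < Nat.card L := Nat.card_pos
  have hHpos : 0 < Nat.card HS := Nat.card_pos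
  have h5 : L.relIndex N' = HS.relIndex L := by
    have key : L.relIndex N' * Nat.card L * Nat.card HS = HS.relIndex L * Nat.card HS * Nat.card L := by
      rw [hNL, hNH, hAL, hLH]
    have : L.relIndex N' * (Nat.card L * Nat.card HS) = HS.relIndex L * (Nat.card L * Nat.card HS) := by
      rw [← mul_assoc, key]; ring
    exact Nat.eq_of_mul_eq_mul_right (Nat.mul_pos hLpos hHpos) this
  rw [h2, h3, h5]

/-- **Exponents: if `c` kills `𝓛_{v₀}/loc_{v₀}(Sel⁽ⁿ⁾)`, then `c • H¹_{𝓛, ⊤ at v₀} ⊆ Sel⁽ⁿ⁾`.** For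
`x ∈ H¹_{𝓛,⊤ at v₀}` the class `c • loc_{v₀} x` annihilates `𝓛_{v₀}` on the left (`⟨c•loc x, y⟩ =
⟨loc x, c•y⟩ = 0` as `c • y ∈ loc Sel`, by reciprocity), hence lies in `𝓛_{v₀}` (Tate local duality for `E`:
`𝓛_{v₀}` is maximal isotropic — tree `forall_mem_kummerSelmerStructure_weilCupProduct_eq_zero_iff_inr`).
[cite: MilneADT2006, Ch. I, Cor. 3.4 and Thm. 4.10(b)] [cite: JetchevSkinnerWan2017, Prop. 3.2.1 (proof)] -/
theorem nsmul_mem_selmerGroup_of_mem_kummerOutside (hPT : poitouTate_selmerStructure_duality K)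
    (hEP : ∀ v : HeightOneSpectrum (𝓞 K), localEulerPoincareCharacteristic (v.adicCompletion K))
    (hk : k ≠ 0) (c : ℕ)
    (hc : ∀ y ∈ W.kummerSelmerStructure ((p ^ k : ℕ) : ℤ) (Sum.inr v₀),
      c • y ∈ (selmerGroup W ((p ^ k : ℕ) : ℤ)).map
        (galoisCohomology.localization (W.torsionGaloisModule ((p ^ k : ℕ) : ℤ)) (Sum.inr v₀) 1)) :
    ∀ ⦃x : galoisCohomology (W.torsionGaloisModule ((p ^ k : ℕ) : ℤ)) 1⦄,
      x ∈ kummerOutside W (p ^ k) {Sum.inr v₀} → c • x ∈ selmerGroup W ((p ^ k : ℕ) : ℤ) := by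
  classical
  haveI : PerfectField K := PerfectField.ofCharZero
  haveI : CharZero (v₀.adicCompletion K) := charZero_adicCompletion v₀
  have hprime : p.Prime := Fact.out
  have hpp : IsPrimePow (p ^ k) := hprime.isPrimePow.pow hk
  have hn2 : 2 ≤ p ^ k := le_trans hprime.two_le (Nat.le_self_pow hk p)
  obtain ⟨e, hμ, hadd₁, hadd₂, halt, hnondeg, hgal⟩ :=
    exists_weilPairing_holds W (p ^ k) hn2 (by exact_mod_cast NeZero.ne (p ^ k))
  obtain ⟨inv, hperf, hsum, -, -⟩ := hPT (p ^ k)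
  have hEuler : Nat.card (galoisCohomology ((W.torsionGaloisModule ((p ^ k : ℕ) : ℤ)).toLocal (Sum.inr v₀)) 1) =
      (Nat.card (nsmulAddMonoidHom (p ^ k) : (W.baseChange (v₀.adicCompletion K)).toAffine.Point →+ _).ker *
        Nat.card (v₀.adicCompletionIntegers K ⧸
          Ideal.span {((p ^ k : ℕ) : v₀.adicCompletionIntegers K)})) ^ 2 :=
    natCard_galoisCohomology_one_torsion_adicCompletion_eq_sq W v₀ (p ^ k) hpp (hEP v₀)
  have hLcard := W.natCard_kummerSelmerStructure_inr v₀ (NeZero.ne (p ^ k))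
  set M := W.torsionGaloisModule ((p ^ k : ℕ) : ℤ) with hM
  set loc := galoisCohomology.localization M (Sum.inr v₀) 1 with hloc
  set b := invWeilPairing W (p ^ k) e hμ hadd₁ hadd₂ hgal inv (Sum.inr v₀) with hb
  set L := W.kummerSelmerStructure ((p ^ k : ℕ) : ℤ) (Sum.inr v₀) with hL
  have hinv : Injective (inv (Sum.inr v₀)) := (hperf v₀).1.1
  intro x hx
  -- `c • loc x` pairs to zero with `L` on the left
  have hz : ∀ y ∈ L, b (c • loc x) y = 0 := by
    intro y hy
    have hswap : b (c • loc x) y = b (loc x) (c • y) := by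
      rw [map_nsmul, AddMonoidHom.nsmul_apply, map_nsmul (b (loc x)) c y]
    rw [hswap]
    obtain ⟨s, hs, hsy⟩ := hc y hy
    have key := invWeilPairing_localization_eq_zero_of_mem_selmerGroup W (p ^ k) e hμ hadd₁ hadd₂ hgal halt
      inv hsum (Sum.inr v₀) hx hs
    rw [← hsy]
    exact key
  -- hence `c • loc x ∈ L` (maximal isotropy)
  have hcard : Nat.card (galoisCohomology (M.toLocal (Sum.inr v₀)) 1) ≤ Nat.card L * Nat.card L := by
    rw [hEuler, hLcard, sq]
  have hmemL : c • loc x ∈ L := by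
    refine (forall_mem_kummerSelmerStructure_weilCupProduct_eq_zero_iff_inr W (p ^ k) e hμ hadd₁ hadd₂ v₀
      hgal halt hnondeg hcard (c • loc x)).mp fun y hy => ?_
    have h1 := hz y hy
    rw [hb, invWeilPairing_apply] at h1
    exact hinv (h1.trans (map_zero _).symm)
  -- conclude
  refine mem_selmerGroup_of_mem_kummerOutside W (p ^ k) (AddSubgroup.nsmul_mem _ hx c) fun v => ?_
  obtain ⟨v, hv⟩ := v
  rw [Finset.mem_singleton] at hv
  subst hv
  change loc (c • x) ∈ L
  rw [map_nsmul]
  exact hmemL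

end Main

end Summit.BirchSwinnertonDyer.Rank1Residual.X11b.Relaxation

end
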